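import Mathlib
import Literature.NumberTheory.LFunctions.Zhang2022.RepairGapCurrencies
import Literature.NumberTheory.LFunctions.Zhang2022.RepairGapExponentBudget
import Literature.NumberTheory.LFunctions.KMVDiagonalSlack
import HarnessLib

/-!
# Zhang (2022), rescue GAP-TABLE (D-0124 (4)): SATISFIABILITY WITNESSES for the conditional kernel certificates of
# the typ-2 δ-currency files (`RepairGapCurrencies` p508243/p510044/p516807, `RepairGapExponentBudget`
# p514950/p515382, `KMVDiagonalSlack` p514040/p520676) — director-frontier g8 W1 rule 2026-08-27T11:10:43Z /
# grammar 11:26:39Z («every (H₁ ∧ … ∧ Hₙ → C) certificate names one object meeting all Hᵢ at once»)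

Topic `Literature/NumberTheory/LFunctions/Zhang2022` (Landau–Siegel audit tree; verdict-neutral).
Y. Zhang, *Discrete mean estimates and the Landau–Siegel zero*, arXiv:2211.02515v1 (2022) [Zhang2022LandauSiegel] —
**an unrefereed manuscript under adjudication; nothing here asserts or denies any of its claims, and nothing here is
a claim about Landau–Siegel zeros.**

Companion of `RepairBedWitnesses`. Each theorem APPLIES one conditional certificate to an explicit object and
discharges ALL its hypotheses at once (kind (a) of the W1 grammar); where the certificate's antecedent is itself a
tree theorem (e.g. `ineq232With_have`, `budgetS0_2000`, `ellWindowV19_of_lt_ratio`, `mainOrderContradiction_of_printed`)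
that theorem is the object. None of these certificates carries an (A)-type antecedent, and none has two binders that
no single object can meet. The numbers used (0.06, 1600, r = 1/3000, w = 68, E = 2022, Δ = 3/2, slopes 0 and 1)
are arbitrary admissible instances, not cells of any table. Theorems only.

## References

* Y. Zhang, arXiv:2211.02515v1 (2022), §2 (2.32)–(2.33), (2.6), (2.9); §7 (7.2). [cite: Zhang2022LandauSiegel, §§2, 7]
* E. Kowalski, P. Michel, J. VanderKam, *Mollification of the fourth moment of automorphic L-functions and
  arithmetic applications*, Invent. Math. 142 (2000), §7. [cite: KowalskiMichelVanderKam2000, §7]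
-/

noncomputable section

open Real Filter Polynomial
open scoped Topology

namespace Literature.NumberTheory.LFunctions.Zhang2022.Repair.Gap

/-! ### `RepairGapCurrencies` -/

/-- Witness for `ineq232With_mono` (`q₁ ≤ q₂`, `Ineq232With c′ q₁`) and `ineq233With_mono`: the HAVE numerals
`ineq232With_have` (q = 0.055363) / `ineq233With_have` (2546.8478) moved up to 0.06 / 2600.
[cite: Zhang2022LandauSiegel, §2 (2.32)–(2.33)] -/
theorem ineqWith_mono_witness :
    (∃ cS : ℝ, ∀ c' ≥ cS, Skeleton.Ineq232With c' 0.06) ∧ (∃ cS : ℝ, ∀ c' ≥ cS, Skeleton.Ineq233With c' 2600) := by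
  obtain ⟨c₁, h₁⟩ := ineq232With_have
  obtain ⟨c₂, h₂⟩ := ineq233With_have
  exact ⟨⟨c₁, fun c' hc' => ineq232With_mono (by norm_num) (h₁ c' hc')⟩,
    ⟨c₂, fun c' hc' => ineq233With_mono (by norm_num) (h₂ c' hc')⟩⟩

/-- Witness for `mainOrderContradiction_anti` (`0 ≤ c₁ ≤ c₁′`, `0 ≤ c₂ ≤ c₂′`, `MOC c₁′ c₂′`): the printed-numbers
instance `mainOrderContradiction_of_printed` at `(0.0005, 2999)` moved down to `(0.0004, 2000)`.
[cite: Zhang2022LandauSiegel, §2 (2.32)–(2.33)] -/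
theorem mainOrderContradiction_anti_witness : MainOrderContradiction 0.0004 2000 :=
  mainOrderContradiction_anti (by norm_num) (by norm_num) (by norm_num : (0.0004 : ℝ) ≤ 0.0005)
    (by norm_num : (2000 : ℝ) ≤ 2999) (mainOrderContradiction_of_printed (by norm_num) (by norm_num) (by norm_num))

/-- Witness for `ellWindow_mono` (`0 ≤ Amax ≤ Amax′`, `0 ≤ c`, `0 < ccrit`, `EllWindow …`): the window object of
`ellWindowV19_of_lt_ratio` at `r = 1/3000 > 1/3180` (`A = 1590`, `B = 0.53`), widened to `Amax′ = 1600`.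
[cite: Zhang2022LandauSiegel, §2 (2.6), (2.9)] -/
theorem ellWindow_mono_witness : EllWindow 920 1600 0.638 (1 / 3000) 0 1590 (1 / 3000 * 1590) :=
  ellWindow_mono (by norm_num) (by norm_num) le_rfl (by norm_num) (ellWindowV19_of_lt_ratio (by norm_num))

/-- Witness for `not_ellWindow_of_ratio_le` (`0 < Amax`, `0 ≤ A0`, `0 ≤ c`, `0 < ccrit`, `r ≤ 1/(2Amax)`) and
`not_ellWindowV19_ordered/printExact/of_ratio_le` (`0 ≤ c`, `r ≤ 1/3180`): the census numbers with `c = 0`.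
[cite: Zhang2022LandauSiegel, §2 (2.6), (2.9)] -/
theorem not_ellWindow_witness (A B : ℝ) :
    ¬ EllWindow 920 1590 0.638 (1 / 3180) 0 A B ∧ ¬ EllWindowV19 (3 / 10000) 0 A B ∧
      ¬ EllWindowV19 (2 / 10000) 0 A B ∧ ¬ EllWindowV19 (1 / 3180) 0 A B :=
  ⟨not_ellWindow_of_ratio_le (by norm_num) (by norm_num) le_rfl (by norm_num) (by norm_num),
    not_ellWindowV19_ordered le_rfl, not_ellWindowV19_printExact le_rfl,
    not_ellWindowV19_of_ratio_le le_rfl le_rfl⟩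

/-- Witness for `three_le_genericLoss_sub_bandRoom` / `not_genericLoss_lt_bandRoom` (`0 ≤ w`): the printed window
exponent `w = 68` at `x_P = 9`. [cite: Zhang2022LandauSiegel, §2 (2.6), (2.9); §7 (7.2)] -/
theorem bandRoom_witness : 3 ≤ genericLoss 9 68 - bandRoom 9 ∧ ¬ genericLoss 9 68 < bandRoom 9 :=
  ⟨three_le_genericLoss_sub_bandRoom 9 (by norm_num), not_genericLoss_lt_bandRoom 9 (by norm_num)⟩

/-! ### `RepairGapExponentBudget` -/

/-- Witness for `le_of_budgetS0` (`Budget`), `budgetS0_of_le` (`2000 ≤ E`) and `le_of_budgetS1`: the tree's own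
feasible points `budgetS0_2000`, `E = 2022`, `budgetS1_min`. [cite: Zhang2022LandauSiegel, §2 (2.6), (2.9)] -/
theorem budget_witness :
    (2000 : ℝ) ≤ 2000 ∧ (ExpTuple.printedWithE 2022).Budget ∧ (36291 / 20 : ℝ) ≤ 36291 / 20 :=
  ⟨ExpTuple.le_of_budgetS0 ExpTuple.budgetS0_2000, ExpTuple.budgetS0_of_le (by norm_num),
    ExpTuple.le_of_budgetS1 ExpTuple.budgetS1_min⟩

/-! ### `KMVDiagonalSlack` (namespace `KMV2000`) -/

/-- Witness for `quarter_lt_valueWith_zero_iff` / `quarter_lt_valueWith_iff` / `lt_diagSlack_iff_rel` /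
`diagSlack_pos_iff` (`0 < second (+ T₂)`) and `quarter_lt_valueWith_X_sq_iff` (`0 < Δ`, `0 < 4 + 4/Δ + T₂`):
`P = X²`, `Q = 1`, `Δ = 3/2`, `T₂ = 0` (`second = 4 + 8/3 > 0`). [cite: KowalskiMichelVanderKam2000, §7] -/
theorem kmv_positivity_witness :
    (1 / 4 < KMV2000.valueWith (3 / 2) (X ^ 2) 1 0 0 ↔ (0 : ℝ) < KMV2000.diagSlack (3 / 2) (X ^ 2) 1) ∧
    (1 / 4 < KMV2000.valueWith (3 / 2) (X ^ 2) 1 0 0 ↔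
      (0 : ℝ) < 2 * (KMV2000.linForm (3 / 2) (X ^ 2) 1 + 0) ^ 2 - KMV2000.secondMomentForm (3 / 2) (X ^ 2) 1) ∧
    ((0 : ℝ) < KMV2000.diagSlack (3 / 2) (X ^ 2) 1 ↔
      0 / KMV2000.secondMomentForm (3 / 2) (X ^ 2) 1 < KMV2000.diagSlackRel (3 / 2) (X ^ 2) 1) ∧
    (0 < KMV2000.diagSlack (3 / 2) (X ^ 2) 1 ↔ 1 / 4 < KMV2000.ratio (3 / 2) (X ^ 2) 1) ∧
    (1 / 4 < KMV2000.valueWith (3 / 2) (X ^ 2) 1 0 0 ↔ 0 / (4 + 4 / (3 / 2 : ℝ)) < (3 / 2 - 1) / (3 / 2 + 1)) := by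
  have hsec : (0 : ℝ) < KMV2000.secondMomentForm (3 / 2) (X ^ 2) 1 := by
    rw [KMV2000.secondMomentForm_X_sq_one]; norm_num
  have hsec0 : (0 : ℝ) < KMV2000.secondMomentForm (3 / 2) (X ^ 2) 1 + 0 := by rwa [add_zero]
  exact ⟨KMV2000.quarter_lt_valueWith_zero_iff hsec0, KMV2000.quarter_lt_valueWith_iff hsec0,
    KMV2000.lt_diagSlack_iff_rel hsec, KMV2000.diagSlack_pos_iff hsec,
    KMV2000.quarter_lt_valueWith_X_sq_iff (by norm_num) (by norm_num)⟩

/-- Witness for `relT₂_lt_half_linear_of_beats` (`0 < Δ`, `0 < 4 + 4/Δ + T₂`, `¼ < valueWith Δ X² 1 0 T₂`):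
`Δ = 3/2`, `T₂ = 0` beats the quarter (tolerance `(Δ−1)/(Δ+1) = 1/5 > 0`). [cite: KowalskiMichelVanderKam2000, §7] -/
theorem relT₂_beats_witness : 0 / (4 + 4 / (3 / 2 : ℝ)) < (3 / 2 - 1) / 2 := by
  have hbeat : 1 / 4 < KMV2000.valueWith (3 / 2) (X ^ 2) 1 0 0 :=
    (KMV2000.quarter_lt_valueWith_X_sq_iff (by norm_num) (by norm_num)).2 (by norm_num)
  exact KMV2000.relT₂_lt_half_linear_of_beats (by norm_num) (by norm_num) hbeat

/-- Witness for the slope certificates with `s < ½` (`eventually_lt_tolerance_of_slope_lt_half`,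
`eventually_quarter_lt_valueWith_of_slope_lt_half`): the zero off-diagonal reading `r = T₂ = 0`, slope `s = 0`.
[cite: KowalskiMichelVanderKam2000, §7] -/
theorem slope_lt_half_witness :
    (∀ᶠ Δ in 𝓝[>] (1 : ℝ), (fun _ => (0 : ℝ)) Δ < (Δ - 1) / (Δ + 1)) ∧
      ∀ᶠ Δ in 𝓝[>] (1 : ℝ), 1 / 4 < KMV2000.valueWith Δ (X ^ 2) 1 0 ((fun _ => (0 : ℝ)) Δ) := by
  have h0 : Tendsto (fun Δ : ℝ => (fun _ => (0 : ℝ)) Δ / (Δ - 1)) (𝓝[>] (1 : ℝ)) (𝓝 0) := by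
    simp only [zero_div]; exact tendsto_const_nhds
  have h0' : Tendsto (fun Δ : ℝ => (fun _ => (0 : ℝ)) Δ / (4 + 4 / Δ) / (Δ - 1)) (𝓝[>] (1 : ℝ)) (𝓝 0) := by
    simp only [zero_div]; exact tendsto_const_nhds
  have hpos : ∀ᶠ Δ in 𝓝[>] (1 : ℝ), 0 < 4 + 4 / Δ + (fun _ => (0 : ℝ)) Δ := by
    filter_upwards [eventually_mem_nhdsWithin] with Δ hΔ
    have hΔ' : (0 : ℝ) < Δ := lt_trans one_pos hΔ
    positivity
  exact ⟨KMV2000.eventually_lt_tolerance_of_slope_lt_half h0 (by norm_num),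
    KMV2000.eventually_quarter_lt_valueWith_of_slope_lt_half h0' (by norm_num) hpos⟩

/-- Witness for the slope certificates with `½ < s` (`eventually_tolerance_lt_of_half_lt_slope`,
`eventually_valueWith_le_quarter_of_half_lt_slope`): the readings `r(Δ) = Δ − 1`, `T₂(Δ) = (4 + 4/Δ)(Δ − 1)`, slope
`s = 1`. [cite: KowalskiMichelVanderKam2000, §7] -/
theorem half_lt_slope_witness :
    (∀ᶠ Δ in 𝓝[>] (1 : ℝ), (Δ - 1) / (Δ + 1) < (fun Δ : ℝ => Δ - 1) Δ) ∧
      ∀ᶠ Δ in 𝓝[>] (1 : ℝ),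
        KMV2000.valueWith Δ (X ^ 2) 1 0 ((fun Δ : ℝ => (4 + 4 / Δ) * (Δ - 1)) Δ) ≤ 1 / 4 := by
  have hgt : ∀ᶠ Δ in 𝓝[>] (1 : ℝ), 1 < Δ := eventually_mem_nhdsWithin
  have h1 : Tendsto (fun Δ : ℝ => (fun Δ : ℝ => Δ - 1) Δ / (Δ - 1)) (𝓝[>] (1 : ℝ)) (𝓝 1) := by
    refine (tendsto_const_nhds (x := (1 : ℝ))).congr' ?_
    filter_upwards [hgt] with Δ hΔ
    exact (div_self (sub_ne_zero.2 (ne_of_gt hΔ))).symm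
  have h1' : Tendsto (fun Δ : ℝ => (fun Δ : ℝ => (4 + 4 / Δ) * (Δ - 1)) Δ / (4 + 4 / Δ) / (Δ - 1))
      (𝓝[>] (1 : ℝ)) (𝓝 1) := by
    refine (tendsto_const_nhds (x := (1 : ℝ))).congr' ?_
    filter_upwards [hgt] with Δ hΔ
    have hΔ0 : (0 : ℝ) < Δ := lt_trans one_pos hΔ
    have h4 : (4 + 4 / Δ : ℝ) ≠ 0 := by positivity
    have hd : (Δ - 1 : ℝ) ≠ 0 := sub_ne_zero.2 (ne_of_gt hΔ)
    field_simp
  have hpos : ∀ᶠ Δ in 𝓝[>] (1 : ℝ), 0 < 4 + 4 / Δ + (fun Δ : ℝ => (4 + 4 / Δ) * (Δ - 1)) Δ := by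
    filter_upwards [hgt] with Δ hΔ
    have hΔ0 : (0 : ℝ) < Δ := lt_trans one_pos hΔ
    have : (0 : ℝ) < Δ - 1 := by linarith
    positivity
  exact ⟨KMV2000.eventually_tolerance_lt_of_half_lt_slope h1 (by norm_num),
    KMV2000.eventually_valueWith_le_quarter_of_half_lt_slope h1' (by norm_num) hpos⟩

end Literature.NumberTheory.LFunctions.Zhang2022.Repair.Gap
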